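import Summits.QuantumFields.YangMills.Theorems.LuscherReductionDressedRitzPolyakovLiftTransplantRoot
import Summits.QuantumFields.YangMills.Theorems.LuscherReductionOneSiteLevelsGnHaar
import HarnessLib

/-!
# Route `LuscherReduction`, item `DressedRitz` (stmt-QuantumFields-20205), line «polyakovlift» r6, stub S-PSCAL″ — THE MAIN TERM IS EXACT (a.e.):
# `(g_i ∘ powLink L) · Φ̂₀ = Ψ_{i+1}` almost everywhere (F9 groundwork; LEAD prover ym-lead-20205-polyakovlift g2)

With `g_i = transplantObsL L Λ R f i` (root-transplant observable, tree `…PolyakovLiftTransplantRoot`), `μ = Λ/(2L)`, the vacuum quasimode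
`Φ̂₀ := (χ_{2R} f_0) ∘ gnCoord μ` and the excited quasimode `Ψ_{i+1} := (χ_R f_{i+1}) ∘ gnCoord μ` of the LOWER lane:
`(g_i ∘ powLink L)(U) · Φ̂₀(U) = Ψ_{i+1}(U)` for every `U` all of whose links are off the equator `{scalarPart = 0}` — a null set.  Ingredients: the equator is
Haar-null (gnomonic decomposition of Haar, `haarProbability_su2_eq_gnomonic`); points in the support of `Φ̂₀` are `L`-near-centre (`gnNorm U_j ≤ μ‖y‖`,
`Lμ·2√2R ≤ √2/4 < π/2`); the dilation identity `transplantObsL_powLink`; `χ_{2R} = 1` on the support of `χ_R`; `f_0 > 0` cancels.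

* `haar_scalarPart_eq_zero`, `ae_scalarPart_ne_zero` (one-site); `linkNormSq_le_norm_sq`, `isNearCentre_of_gnCoord`;
* ★ `shadowObs_mul_ground_eq` (pointwise off the equator) and ★ `shadowObs_mul_ground_ae` (a.e.).

HONEST FRAMING: chart bookkeeping (conditional femto rung R2b1); nothing here bears on infinite volume, the continuum limit or the Clay gap.
References: M. Lüscher, NPB 219 (1983) 233 [cite: Luscher1983, §2–§3]; Bröcker–tom Dieck I (1.10) [cite: BrockerTomDieck1985, I (1.10)].
-/

set_option autoImplicit false

noncomputable section

open MeasureTheory Filter Topology Real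
open Literature.MathematicalPhysics.QuantumFieldTheory (GaugeConfig Site gaugeTransform haarProbability)
open Literature.Analysis.OperatorTheory.YMMatrixModel
open Literature.MathematicalPhysics.QuantumFieldTheory.Balaban1983to89.T4CubeChartGnomonic (gnoPoint continuous_gnoPoint)
open scoped BigOperators

namespace Summit.QuantumFields.YangMills.Theorems.FemtoTransferGap.PolyakovLift

open Summit.QuantumFields.YangMills.Theorems.FemtoTransferGap

/-! ## §1 The equator is null -/

/-- The equator `{scalarPart = 0}` of `SU(2)` is Haar-null (both gnomonic hemisphere charts miss it). [folklore] -/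
theorem haar_scalarPart_eq_zero :
    haarProbability SU2 {W : SU2 | scalarPart W = 0} = 0 := by
  haveI := Literature.MathematicalPhysics.QuantumLattice.secondCountableTopology_su2
  have hE : MeasurableSet {W : SU2 | scalarPart W = 0} := (continuous_scalarPart.measurable (measurableSet_singleton 0))
  have hP : Measurable gnoPoint := continuous_gnoPoint.measurable
  have hN : Measurable fun v : Fin 3 → ℝ => negOne * gnoPoint v := (continuous_const.mul continuous_gnoPoint).measurable
  rw [haarProbability_su2_eq_gnomonic, Measure.add_apply, Measure.map_apply hP hE, Measure.map_apply hN hE]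
  have h1 : gnoPoint ⁻¹' {W : SU2 | scalarPart W = 0} = ∅ := by
    ext v
    simp only [Set.mem_preimage, Set.mem_setOf_eq, Set.mem_empty_iff_false, iff_false]
    exact (scalarPart_gnoPoint_pos v).ne'
  have h2 : (fun v : Fin 3 → ℝ => negOne * gnoPoint v) ⁻¹' {W : SU2 | scalarPart W = 0} = ∅ := by
    ext v
    simp only [Set.mem_preimage, Set.mem_setOf_eq, Set.mem_empty_iff_false, iff_false, scalarPart_negOne_mul, neg_eq_zero]
    exact (scalarPart_gnoPoint_pos v).ne'
  rw [h1, h2, measure_empty, add_zero]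

/-- ★ Almost every one-site configuration has all links off the equator. [folklore] -/
theorem ae_scalarPart_ne_zero : ∀ᵐ U ∂(configMeasure SU2 1), ∀ e, scalarPart (U e) ≠ 0 := by
  haveI := Literature.MathematicalPhysics.QuantumLattice.secondCountableTopology_su2
  have hE : MeasurableSet {W : SU2 | scalarPart W = 0} := (continuous_scalarPart.measurable (measurableSet_singleton 0))
  rw [ae_all_iff]
  intro e
  have : (configMeasure SU2 1) {U : Cfg | scalarPart (U e) = 0} = 0 := by
    have hsub : {U : Cfg | scalarPart (U e) = 0} = (fun U : Cfg => U e) ⁻¹' {W : SU2 | scalarPart W = 0} := rfl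
    rw [hsub, ← Measure.map_apply (measurable_pi_apply e) hE]
    unfold configMeasure
    rw [Measure.pi_map_eval]
    simp [haar_scalarPart_eq_zero]
  rw [ae_iff]
  simpa using this

/-! ## §2 Points in the chart ball are near-centre -/

/-- `linkNormSq y j ≤ ‖y‖²`. [folklore] -/
theorem linkNormSq_le_norm_sq (y : ZM) (j : Fin 3) : linkNormSq y j ≤ ‖y‖ ^ 2 := by
  rw [EuclideanSpace.real_norm_sq_eq, Fintype.sum_prod_type]
  exact Finset.single_le_sum (f := fun i => ∑ a, y (i, a) ^ 2) (fun i _ => Finset.sum_nonneg fun a _ => sq_nonneg _)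
    (Finset.mem_univ j)

/-- `gnNorm (U_j) ≤ μ‖gnCoord μ U‖` for `μ > 0`. [folklore] -/
theorem gnNorm_le_mul_norm_gnCoord {μ : ℝ} (hμ : 0 < μ) (U : Cfg) (j : Fin 3) : gnNorm (U (edgeOf j)) ≤ μ * ‖gnCoord μ U‖ := by
  have h1 : gnNorm (U (edgeOf j)) ^ 2 = μ ^ 2 * linkNormSq (gnCoord μ U) j := by
    rw [gnNorm, Real.sq_sqrt (Finset.sum_nonneg fun _ _ => sq_nonneg _), linkNormSq_gnCoord, mul_div_cancel₀ _ (pow_ne_zero 2 hμ.ne')]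
  have h2 : gnNorm (U (edgeOf j)) ^ 2 ≤ (μ * ‖gnCoord μ U‖) ^ 2 := by
    rw [h1, mul_pow]; exact mul_le_mul_of_nonneg_left (linkNormSq_le_norm_sq _ _) (sq_nonneg _)
  exact (pow_le_pow_iff_left₀ (gnNorm_nonneg _) (mul_nonneg hμ.le (norm_nonneg _)) two_ne_zero).1 h2

/-- ★ A configuration off the equator whose gnomonic coordinate at scale `μ` has `L·μ·‖y‖ < π/2` is `L`-near-centre on every link. [folklore] -/
theorem isNearCentre_of_gnCoord {μ : ℝ} (hμ : 0 < μ) {L : ℕ} {U : Cfg} (hoff : ∀ e, scalarPart (U e) ≠ 0)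
    (hsmall : (L : ℝ) * (μ * ‖gnCoord μ U‖) < π / 2) (j : Fin 3) : IsNearCentre L (U (edgeOf j)) := by
  have hg : (L : ℝ) * Real.arctan (gnNorm (U (edgeOf j))) < π / 2 := by
    have h1 : Real.arctan (gnNorm (U (edgeOf j))) ≤ gnNorm (U (edgeOf j)) := by
      rcases (gnNorm_nonneg (U (edgeOf j))).eq_or_lt with h0 | hpos
      · rw [← h0, Real.arctan_zero]
      · have := (arctan_div_pos_le_one hpos).2
        rwa [div_le_one hpos] at this
    calc (L : ℝ) * Real.arctan (gnNorm (U (edgeOf j))) ≤ (L : ℝ) * (μ * ‖gnCoord μ U‖) :=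
          mul_le_mul_of_nonneg_left (h1.trans (gnNorm_le_mul_norm_gnCoord hμ U j)) (Nat.cast_nonneg L)
      _ < π / 2 := hsmall
  rcases lt_or_gt_of_ne (hoff (edgeOf j)) with hneg | hpos
  · right
    refine ⟨by rw [scalarPart_negOne_mul]; linarith, ?_⟩
    have : gnNorm (negOne * U (edgeOf j)) = gnNorm (U (edgeOf j)) := by rw [gnNorm, gnNorm, gnLink_negOne_mul]
    rwa [this]
  · left; exact ⟨hpos, hg⟩

/-! ## §3 ★ The main term is exact off the equator -/

variable {k : ℕ}

/-- ★ **`(g_i ∘ powLink L)(U) · Φ̂₀(U) = Ψ_{i+1}(U)` off the equator**: `g_i = transplantObsL L Λ R f i`, `μ = Λ/(2L)`, `Φ̂₀ = (χ_{2R}f_0)∘gnCoord μ`,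
`Ψ_{i+1} = (χ_R f_{i+1}) ∘ gnCoord μ`; `0 < Λ`, `1 ≤ L`, `0 < R`, `RΛ ≤ 1/4`, `f_0 > 0`. [cite: Luscher1983, §2–§3] -/
theorem shadowObs_mul_ground_eq {Λ R : ℝ} (hΛ : 0 < Λ) (hR : 0 < R) (hRΛ : R * Λ ≤ 1 / 4) {L : ℕ} (hL : 0 < L)
    (f : Fin (k + 1) → ZM → ℝ) (hpos : ∀ x, 0 < f 0 x) (i : Fin k) {U : Cfg} (hoff : ∀ e, scalarPart (U e) ≠ 0) :
    transplantObsL L Λ R f i (powLink L U) * (radialCutoff (2 * R) (gnCoord (Λ / (2 * L)) U) * f 0 (gnCoord (Λ / (2 * L)) U)) =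
      radialCutoff R (gnCoord (Λ / (2 * L)) U) * f i.succ (gnCoord (Λ / (2 * L)) U) := by
  have hL' : (0 : ℝ) < L := Nat.cast_pos.mpr hL
  set μ : ℝ := Λ / (2 * L) with hμdef
  have hμ : 0 < μ := div_pos hΛ (by positivity)
  set y := gnCoord μ U with hy
  by_cases hfar : 2 * (2 * R) ^ 2 ≤ ‖y‖ ^ 2
  · -- far from the centre: both cut-offs vanish
    have h2R : radialCutoff (2 * R) y = 0 := radialCutoff_eq_zero (by positivity) hfar
    have hR0 : radialCutoff R y = 0 := radialCutoff_eq_zero hR (by nlinarith [hfar, sq_nonneg R])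
    rw [h2R, hR0, zero_mul, zero_mul, mul_zero]
  · -- near the centre: the dilation identity applies
    push Not at hfar
    have hnorm : ‖y‖ < 2 * Real.sqrt 2 * R := by
      have h0 : 0 ≤ ‖y‖ := norm_nonneg _
      have : ‖y‖ ^ 2 < (2 * Real.sqrt 2 * R) ^ 2 := by
        have e : (2 * Real.sqrt 2 * R) ^ 2 = 2 * (2 * R) ^ 2 := by
          rw [mul_pow, mul_pow, Real.sq_sqrt (by norm_num : (0:ℝ) ≤ 2)]; ring
        rw [e]; exact hfar
      exact lt_of_pow_lt_pow_left₀ 2 (by positivity) this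
    have hsmall : (L : ℝ) * (μ * ‖y‖) < π / 2 := by
      have h1 : (L : ℝ) * (μ * ‖y‖) ≤ (L : ℝ) * (μ * (2 * Real.sqrt 2 * R)) :=
        mul_le_mul_of_nonneg_left (mul_le_mul_of_nonneg_left hnorm.le hμ.le) hL'.le
      have h2 : (L : ℝ) * (μ * (2 * Real.sqrt 2 * R)) = Real.sqrt 2 * (R * Λ) := by
        rw [hμdef]; field_simp
      have h3 : Real.sqrt 2 * (R * Λ) ≤ Real.sqrt 2 * (1 / 4) := mul_le_mul_of_nonneg_left hRΛ (Real.sqrt_nonneg 2)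
      have h4 : Real.sqrt 2 * (1 / 4) < π / 2 := by
        have hs : Real.sqrt 2 < 2 := by
          rw [show (2:ℝ) = Real.sqrt 4 by rw [show (4:ℝ) = 2 ^ 2 by norm_num, Real.sqrt_sq (by norm_num : (0:ℝ) ≤ 2)]]
          exact Real.sqrt_lt_sqrt (by norm_num) (by norm_num)
        linarith [Real.pi_gt_three]
      linarith
    have hnc : ∀ j : Fin 3, IsNearCentre L (U (edgeOf j)) := fun j => isNearCentre_of_gnCoord hμ hoff (by rwa [← hy]) j
    rw [transplantObsL_powLink hL hΛ R f i hnc, transplantFn]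
    show radialCutoff R y * (f i.succ y / f 0 y) * (radialCutoff (2 * R) y * f 0 y) = radialCutoff R y * f i.succ y
    by_cases hRy : radialCutoff R y = 0
    · rw [hRy]; ring
    · have hy2 : ‖y‖ ^ 2 < 2 * R ^ 2 := by
        by_contra hcon; push Not at hcon; exact hRy (radialCutoff_eq_zero hR hcon)
      have hyle : ‖y‖ ≤ 2 * R := by
        have h0 : 0 ≤ ‖y‖ := norm_nonneg _
        nlinarith [hy2, sq_nonneg (‖y‖ - 2 * R), hR]
      rw [radialCutoff_eq_one (by positivity) hyle]
      field_simp [(hpos y).ne']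

/-- ★★ **The main term of the shadow insertion is the LOWER lane's excited quasimode, almost everywhere.** [cite: Luscher1983, §2–§3] -/
theorem shadowObs_mul_ground_ae {Λ R : ℝ} (hΛ : 0 < Λ) (hR : 0 < R) (hRΛ : R * Λ ≤ 1 / 4) {L : ℕ} (hL : 0 < L)
    (f : Fin (k + 1) → ZM → ℝ) (hpos : ∀ x, 0 < f 0 x) (i : Fin k) :
    (fun U : Cfg => transplantObsL L Λ R f i (powLink L U) *
        (radialCutoff (2 * R) (gnCoord (Λ / (2 * L)) U) * f 0 (gnCoord (Λ / (2 * L)) U))) =ᵐ[configMeasure SU2 1]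
      fun U => radialCutoff R (gnCoord (Λ / (2 * L)) U) * f i.succ (gnCoord (Λ / (2 * L)) U) := by
  filter_upwards [ae_scalarPart_ne_zero] with U hU
  exact shadowObs_mul_ground_eq hΛ hR hRΛ hL f hpos i hU

end Summit.QuantumFields.YangMills.Theorems.FemtoTransferGap.PolyakovLift

end
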